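/-
Origin: expansion seat `prover-pub-hodgecm-mc-binder-1-g17-0`, handover #R117r2 2026-08-20T22:31:33Z md5 abd866308f1d (125 l.; REPLACE of HodgeCM/Model/TowerTransfer.lean — PKG file now 5c46820bd27c (200 l., incl. packager Origin header); body of record 0c1001f868c7 (196 l.) → abd866308f1d; owner binder-1 #R117 (RUN 64); +import Model.LevelDeckTransfer; exists_trPull_one_eq_of_invariant := #R122 …_free, minus h₂ (196 → 125 l.); exists_mem_Γ_map_eq/levelHomeo_mk_smul/levelHomeo_smul kept verbatim; NAMES for audit: HodgeCM.Model.TowerTransfer.exists_trPull_one_eq_of_invariant · HodgeCM.Model.TowerTransfer.levelHomeo_smul · HodgeCM.Model.TowerTransfer.levelHomeo_mk_smul) (`HOME/mc/pub-hodgecm-mc-binder-1-g17/campaign/new/TowerTransfer.lean`, md5 abd866308f1d, 125 lines);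
landed by the gen-27 packager (p-g27) in gate run 65 REPLACES the earlier landed copy of `HodgeCM/Model/TowerTransfer.lean` (verbatim).
-/
/-
Copyright (c) 2026 the pub-hodgecm formalisation cell (harness21).  New file, not vendored.
Origin: session prover-pub-hodgecm-mc-binder-1-g16-0 (unit pub-hodgecm-mc-binder-1-g16, BINDER PROVER gen 16 of lineage mc-binder-1;
content lane (J-Liu-Θ), (J3) HECKE-TOWER sub-leaf (T4)-strong, part 1: transfer — deck-invariant classes on a normal level cover descend), 2026-08-20.
-/
import Summits.HodgeConjecture.HodgeCM.Model.TowerInjective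
import Summits.HodgeConjecture.HodgeCM.Model.LevelDeckTransfer
import Literature.AlgebraicGeometry.HodgeTheory.HodgeStructureOfHodgeModel

/-!
# Transfer for the level coverings of the model: deck-invariant classes descend

For levels `Δ'' ≤ Δ` of one hermitian space with `Δ''.Γ ⊴ Δ.Γ`, the pull-back `t_1^* : Hᵏ(X_Δ(ℂ);ℚ)_ℂ → Hᵏ(X_{Δ''}(ℂ);ℚ)_ℂ`
(injective, #R110) has as IMAGE exactly the classes invariant under the deck transformations — which, on the algebraic model, are the
rational translates `t_γ : X_{Δ''} ⟶ X_{Δ''}`, `γ ∈ Δ.Γ` (#R107):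

* `exists_trPull_one_eq_of_invariant` — `(∀ γ ∈ Δ.Γ, t_γ^* z = z) → ∃ y, t_1^* y = z`.

Proof: Hatcher's transfer `p^*(τ w) = Σ_{q ∈ Γ/N} q^* w` (vendored `FiniteDeckCover.map_proj_transferMap`) for the topological cover
`N\𝔹 → X(ℂ)` (`levelDeckCover`, #R99's covering-map input), transported to the algebraic model `X_{Δ''}` by #R95's `levelHomeo`
(`levelHomeo ∘ (q • ·) = t_γ(ℂ) ∘ levelHomeo`: `levelHomeo_smul`), and universal coefficients `ℂ ⊗ Hᵏ(·;ℚ) ≅ Hᵏ(·;ℂ)`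
(vendored `ofRatClassBaseChange_injective/_surjective`, `map_ofRatClassBaseChange`).
Part 2 (`Model/TowerFixed`) turns this into `fixedBy Γ.K (Tower) = levelImage Γ` on the tower.

**(iib-T) re-cut (binder-1-g17):** `exists_trPull_one_eq_of_invariant` NO LONGER takes `h₂ : SpecialCyclesAlgebraic` — it is now
`Model/LevelDeckTransfer.exists_trPull_one_eq_of_invariant_free` (the finite regular covering built directly on the model's complex points,
(ii-b)-free).  Records: the universe's, `hA`.  The quotient-datum lemmas `exists_mem_Γ_map_eq` / `levelHomeo_smul` (which do take `h₂`)
and the generic `levelHomeo_mk_smul` are kept verbatim as library lemmas; nothing on the path to `fixedBy_eq_levelImage` uses them any more.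
-/

noncomputable section

open scoped Matrix
open Matrix Function Set
open NumberField CategoryTheory
open Literature.AlgebraicGeometry.Motives
open Literature.AlgebraicGeometry.ShimuraVarieties
open Literature.AlgebraicGeometry.HodgeTheory
open Literature.AlgebraicTopology.SingularHomology
open Literature.Topology.CoveringSpaces
open Literature.NumberTheory.Automorphic
open Literature.NumberTheory.Automorphic.PicardCM
open Literature.NumberTheory.Transcendental (Arapura2012_Cor_15_4_6)

namespace HodgeCM.Model.TowerTransfer

open UnitaryBallQuotientDatum HodgeCM.Model.LevelTranslate HodgeCM.Model.TowerLevel HodgeCM.Model.TowerInjective HodgeCM.Model.LevelCoverAlgebraic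
  HodgeCM.Model.HeckeAdmissible HodgeCM.Model.HeckeHodgeType

variable (hHD : exists_isReal_hodgeModel) (hI : hodgePQ_independent_of_hodgeModel)
  (hU : BallQuotientUniformisedDatum) (h₃ : CMAbelianVarietyRealised) (hA : Arapura2012_Cor_15_4_6) (h₂ : SpecialCyclesAlgebraic)
variable {L : CMField} {ι₁ : L →+* ℂ} {V : HermSpace3 L ι₁} {Δ Δ'' : Level V}

/-- For a normal sublevel `Δ''.Γ ⊴ Δ.Γ`, every `γ ∈ Δ.Γ` translates `X_{Δ''}` to itself. -/
theorem transCond_self_of_normal (hN : (Δ''.Γ.subgroupOf Δ.Γ).Normal) (hle : Δ'' ≤ Δ) {γ : GL (Fin 3) L} (hγ : γ ∈ Δ.Γ) :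
    TransCond γ Δ'' Δ'' :=
  TransCond.iff.mpr fun δ hδ ↦ by
    have h := hN.conj_mem ⟨δ, Level.Γ_mono hle hδ⟩ (Subgroup.mem_subgroupOf.mpr hδ) ⟨γ, hγ⟩
    exact Subgroup.mem_subgroupOf.mp h

/-- Every element of the quotient datum's `Γ` is, through `τ₁`, the `ι₁`-image of an element of `Δ.Γ`. -/
theorem exists_mem_Γ_map_eq (hV : IsAnisotropic L V.Hm)
    (γ : ↥(modelQuotientDatum (hHD := hHD) (hI := hI) (hU := hU) (h₃ := h₃) h₂ L ι₁ V Δ hV).Γ) :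
    ∃ γ₀ ∈ Δ.Γ, Matrix.GeneralLinearGroup.map ι₁ γ₀ =
      Matrix.GeneralLinearGroup.map (modelQuotientDatum (hHD := hHD) (hI := hI) (hU := hU) (h₃ := h₃) h₂ L ι₁ V Δ hV).τ₁
        (γ : GL (Fin 3) _) := by
  have h : Matrix.GeneralLinearGroup.map (modelQuotientDatum (hHD := hHD) (hI := hI) (hU := hU) (h₃ := h₃) h₂ L ι₁ V Δ hV).τ₁
      (γ : GL (Fin 3) _) ∈ Δ.Γ.map (Matrix.GeneralLinearGroup.map ι₁) := by
    rw [← range_eq hHD hI hU h₃ h₂ hV]; exact ⟨γ, rfl⟩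
  obtain ⟨γ₀, hγ₀, e⟩ := Subgroup.mem_map.mp h
  exact ⟨γ₀, hγ₀, e⟩

/-- **`levelHomeo` intertwines the deck action of `Γ/N` on `N\\𝔹` with an algebraic self-map of the model lying over `v ↦ γ v`**
(generic form: any `π_γ : X_N ⟶ X_N` with `π_γ(ℂ)(unif_N v) = unif_N (γ v)` on the cone of `D`). -/
theorem levelHomeo_mk_smul {p : ℕ} {X XN : SchemeOver ℂ} (D : UnitaryBallQuotientDatum p X) (N : Subgroup ↥D.Γ) [N.Normal]
    (DN : UnitaryBallUniformisationDatum p XN) (hH : DN.Hℂ = D.Hℂ)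
    (hΓ : DN.Γ.map (Matrix.GeneralLinearGroup.map DN.τ₁) = (N.map D.Γ.subtype).map (Matrix.GeneralLinearGroup.map D.τ₁))
    (γ : ↥D.Γ) (πγ : XN ⟶ XN) (hπ : ∀ v : D.cone, AlgPoints.map πγ (DN.unif v) = DN.unif (D.act γ v)) (e : D.LevelCover N) :
    levelHomeo D N DN hH hΓ ((QuotientGroup.mk γ : ↥D.Γ ⧸ N) • e) = AlgPoints.map πγ (levelHomeo D N DN hH hΓ e) := by
  induction e using Quotient.inductionOn with
  | h b =>
  induction b using Quotient.inductionOn with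
  | h v =>
    change levelHomeo D N DN hH hΓ (D.toLevel N (D.toBall (γ • v))) = AlgPoints.map πγ (levelHomeo D N DN hH hΓ (D.toLevel N (D.toBall v)))
    rw [levelHomeo_toLevel_toBall, levelHomeo_toLevel_toBall, hπ v, coe_subgroup_smul]

/-- **On the model `X_{Δ''} → X_Δ`: `levelHomeo (γN • e) = t_{γ₀}(ℂ) (levelHomeo e)`** whenever `γ₀ ∈ Δ.Γ` has `γ₀^{ι₁} = γ^{τ₁}`
(the deck transformations of the normal level cover are the rational translates `t_{γ₀}`, #R107). -/
theorem levelHomeo_smul (hV : IsAnisotropic L V.Hm) (hle : Δ'' ≤ Δ) (hN : (Δ''.Γ.subgroupOf Δ.Γ).Normal)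
    [(levelSubgroup hHD hI hU h₃ h₂ Δ Δ'' hV).Normal]
    (γ : ↥(modelQuotientDatum (hHD := hHD) (hI := hI) (hU := hU) (h₃ := h₃) h₂ L ι₁ V Δ hV).Γ) {γ₀ : GL (Fin 3) L}
    (hγ₀ : γ₀ ∈ Δ.Γ)
    (he : Matrix.GeneralLinearGroup.map ι₁ γ₀ = Matrix.GeneralLinearGroup.map
      (modelQuotientDatum (hHD := hHD) (hI := hI) (hU := hU) (h₃ := h₃) h₂ L ι₁ V Δ hV).τ₁ (γ : GL (Fin 3) _))
    (e : (modelQuotientDatum (hHD := hHD) (hI := hI) (hU := hU) (h₃ := h₃) h₂ L ι₁ V Δ hV).LevelCover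
      (levelSubgroup hHD hI hU h₃ h₂ Δ Δ'' hV)) :
    levelHomeo (modelQuotientDatum (hHD := hHD) (hI := hI) (hU := hU) (h₃ := h₃) h₂ L ι₁ V Δ hV) (levelSubgroup hHD hI hU h₃ h₂ Δ Δ'' hV)
        (Var.ballDatum hU h₃ (pmsCode L ι₁ V Δ'') ((isAnisotropic_pmsCode_iff L ι₁ V Δ'').2 hV))
        (ballDatum_Hℂ_eq hU h₃ Δ Δ'' _ _) (map_Γ_eq hHD hI hU h₃ h₂ hV hle)
        ((QuotientGroup.mk γ : _ ⧸ levelSubgroup hHD hI hU h₃ h₂ Δ Δ'' hV) • e) =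
      AlgPoints.map (transMor hU h₃ hHD hA (Δ.Γ_le_rational hγ₀) Δ'' Δ'' (transCond_self_of_normal hN hle hγ₀))
        (levelHomeo (modelQuotientDatum (hHD := hHD) (hI := hI) (hU := hU) (h₃ := h₃) h₂ L ι₁ V Δ hV)
          (levelSubgroup hHD hI hU h₃ h₂ Δ Δ'' hV)
          (Var.ballDatum hU h₃ (pmsCode L ι₁ V Δ'') ((isAnisotropic_pmsCode_iff L ι₁ V Δ'').2 hV))
          (ballDatum_Hℂ_eq hU h₃ Δ Δ'' _ _) (map_Γ_eq hHD hI hU h₃ h₂ hV hle) e) := by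
  refine levelHomeo_mk_smul _ _ _ _ _ γ _ (fun v ↦ ?_) e
  rw [map_transMor_unif hU h₃ hHD hA _ _ hV (mem_cone _ _ (ballDatum_Hℂ_eq hU h₃ Δ Δ'' _ _) v)]
  congr 1
  change ((Matrix.GeneralLinearGroup.map ι₁ γ₀ : GL (Fin 3) ℂ) : Matrix (Fin 3) (Fin 3) ℂ) *ᵥ (v : Fin 3 → ℂ) = _
  rw [he]
  rfl

/-- **Deck-invariant classes descend** (normal sublevel `Δ''.Γ ⊴ Δ.Γ`): if `t_γ^* z = z` for every `γ ∈ Δ.Γ` then `z = t_1^* y` for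
some `y ∈ Hᵏ(X_Δ(ℂ);ℚ)_ℂ` — (ii-b)-free since the (iib-T) re-cut: `LevelDeckTransfer.exists_trPull_one_eq_of_invariant_free`
(transfer of the finite regular covering `X_{Δ''}(ℂ) → X_Δ(ℂ)` with deck group `Δ.Γ ⧸ Δ''.Γ` + universal coefficients). -/
theorem exists_trPull_one_eq_of_invariant (hle : Δ'' ≤ Δ) (hN : (Δ''.Γ.subgroupOf Δ.Γ).Normal)
    (ht : TransCond ((1 : ↥(Urat V)) : GL (Fin 3) L) Δ'' Δ) (k : ℕ) (z : Coh hHD hI hU h₃ Δ'' k)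
    (hz : ∀ (γ : GL (Fin 3) L) (hγ : γ ∈ Δ.Γ),
      trPull hHD hI hU h₃ hA ⟨γ, Δ.Γ_le_rational hγ⟩ Δ'' Δ'' (transCond_self_of_normal hN hle hγ) k z = z) :
    ∃ y : Coh hHD hI hU h₃ Δ k, trPull hHD hI hU h₃ hA 1 Δ'' Δ ht k y = z :=
  LevelDeckTransfer.exists_trPull_one_eq_of_invariant_free hHD hI hU h₃ hA hle hN ht k z hz

end HodgeCM.Model.TowerTransfer

end
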